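import Summits.NavierStokesRegularity.NavierStokesRegularity.Theorems.ScalingDefectPeepholeDoorDefs
import Summits.NavierStokesRegularity.NavierStokesRegularity.Theorems.PeepholeVorticityDoorFrameTools
import Literature.Analysis.FluidPDE.HarmonicProbe

/-!
# ScalingDefectPeepholeDoorFrame — door S30 «ScalingDefectPeepholeDoor», plate P4 (frame), part 1: the FRAME REDUCTION
# `AnnularPressureBoundS30 → FrameTransferS30` (ns-s29-p2 g2, DIRECTOR-NS #165 (1); ROUND-28 v2 6cf1a9889313ec10 plate P4)

`FrameTransferS30 : PVVortexDefectPeepholeRegularity → TargetVortexDefectPeephole` (Sketch30v2 §2) is the parabolic change of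
variables `t = T + βs`, `x = x₀ + λz`, `λ² = νβ` of S29 (`PeepholeVorticityDoorFrame`: `pv_typeI_transfer`, `pvFrame_isClassical`,
`isBackwardBoundedAt_of_pv_bound`) PLUS two new ingredients:
* (i) **COVARIANCE of the vorticity defect** (§1, proved): the window fields of `u` at `t̄` and of the rescaled pair
  `v = (λ/ν) u(T + β·, x₀ + λ·)` at `s̄ = (t̄ − T)/β` differ by `F_v = ν^{−1/2} F_u(√ν ·)`, and `ssResidual`/`curl` scale out
  exactly: `vortexDefect 1 F_v z = vortexDefect ν F_u (√ν z)` — the PV peephole is `B(y₀/√ν, r/√ν)` with the SAME `ε`;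
* (ii) **the POINTWISE annular pressure bound (1.16)** for the point-gauged, rescaled pressure — v2's class is Pineau–Vicol's own
  (pointwise `|p| ≤ C_p` on `{1/2 < |z| < 3/4} × [−1,0)`), whereas S29's frame only delivered the INTEGRAL gauged bound.  This is
  the one new analytic estimate of P4 (near/mid/far split of the Riesz pressure under local Type I + energy; L-sized) and is
  ISOLATED here as the text `AnnularPressureBoundS30` (§2); §3 proves `FrameTransferS30` from it (kernel-checked reduction).

WHAT THIS IS NOT: `AnnularPressureBoundS30` is NOT proved here (part 2); nothing about door S30, 0056 or NS regularity is proved.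
-/

noncomputable section

set_option linter.dupNamespace false

namespace Summit.NavierStokesRegularity.NavierStokesRegularity.Theorems.ScalingDefectPeepholeDoor

open MeasureTheory Set Function Filter Topology TopologicalSpace Metric
open scoped RealInnerProductSpace NNReal ENNReal Topology Laplacian
open Literature.Analysis Literature.Analysis.FluidPDE
open Summit.NavierStokesRegularity.NavierStokesRegularity.Theorems.StableStrataDoorDefs (physWindowField)
open Summit.NavierStokesRegularity.NavierStokesRegularity.Theorems.PeepholeVorticityDoor

/-! ## §1 Covariance of the vorticity defect under `F ↦ c⁻¹ F(c ·)` -/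

/-- `N_1(c⁻¹ G(c·))(z) = c⁻¹ N_{c²}(G)(cz)`: the self-similar residual scales out. -/
theorem ssResidual_inv_smul_comp_smul (G : EuclideanSpace ℝ (Fin 3) → EuclideanSpace ℝ (Fin 3)) {c : ℝ} (hc : 0 < c)
    (z : EuclideanSpace ℝ (Fin 3)) :
    ssResidual 1 (fun w => c⁻¹ • G (c • w)) z = c⁻¹ • ssResidual (c ^ 2) G (c • z) := by
  have hc0 : c ≠ 0 := hc.ne'
  unfold ssResidual
  rw [laplacian_const_smul_comp_smul G c⁻¹ hc0 z, fderiv_const_smul_comp_smul_apply G c⁻¹ c z]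
  have h1 : c⁻¹ * c = 1 := inv_mul_cancel₀ hc0
  rw [h1]
  simp only [map_smul, smul_sub, smul_smul, one_smul]
  match_scalars <;> (ring_nf; try simp [mul_inv_cancel₀ hc0])

/-- **covariance**: `𝔇_1(c⁻¹ G(c·))(z) = 𝔇_{c²}(G)(cz)` — no prefactor. -/
theorem vortexDefect_inv_smul_comp_smul (G : EuclideanSpace ℝ (Fin 3) → EuclideanSpace ℝ (Fin 3)) {c : ℝ} (hc : 0 < c)
    (z : EuclideanSpace ℝ (Fin 3)) :
    vortexDefect 1 (fun w => c⁻¹ • G (c • w)) z = vortexDefect (c ^ 2) G (c • z) := by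
  unfold vortexDefect
  have hfun : ssResidual 1 (fun w => c⁻¹ • G (c • w)) = fun w => c⁻¹ • (ssResidual (c ^ 2) G) (c • w) :=
    funext (ssResidual_inv_smul_comp_smul G hc)
  rw [hfun, curl_smul_comp_smul, inv_mul_cancel₀ hc.ne', one_smul]

/-- the window field of the Pineau–Vicol pair at `s̄` is `ν^{−1/2}` times the physical window field at `t̄ = T + βs̄`, read at `√ν z`. -/
theorem physWindowField_pvFrame {ν β T tb : ℝ} (hν : 0 < ν) (hβ : 0 < β)
    (x₀ : EuclideanSpace ℝ (Fin 3)) (u : ℝ → EuclideanSpace ℝ (Fin 3) → EuclideanSpace ℝ (Fin 3)) :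
    physWindowField 0 0 ((Real.sqrt (ν * β) / ν) • stPull β (Real.sqrt (ν * β)) T x₀ u) ((tb - T) / β) =
      fun z => (Real.sqrt ν)⁻¹ • physWindowField T x₀ u tb (Real.sqrt ν • z) := by
  funext z
  have hsν : 0 < Real.sqrt ν := Real.sqrt_pos.2 hν
  have hsβ : 0 < Real.sqrt β := Real.sqrt_pos.2 hβ
  have hsβ0 : Real.sqrt β ≠ 0 := hsβ.ne'
  have hν0 : ν ≠ 0 := hν.ne'
  have hlam : Real.sqrt (ν * β) = Real.sqrt ν * Real.sqrt β := Real.sqrt_mul hν.le β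
  have ha : Real.sqrt (0 - (tb - T) / β) = Real.sqrt (T - tb) / Real.sqrt β := by
    rw [show (0 : ℝ) - (tb - T) / β = (T - tb) / β by ring, Real.sqrt_div' _ hβ.le]
  have htime : T + β * ((tb - T) / β) = tb := by field_simp; ring
  have hcoef : Real.sqrt (T - tb) / Real.sqrt β * (Real.sqrt ν * Real.sqrt β / ν) =
      (Real.sqrt ν)⁻¹ * Real.sqrt (T - tb) := by
    have e : Real.sqrt (T - tb) / Real.sqrt β * (Real.sqrt ν * Real.sqrt β / ν) =
        Real.sqrt (T - tb) * (Real.sqrt ν / ν) * (Real.sqrt β / Real.sqrt β) := by ring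
    rw [e, div_self hsβ0, mul_one, Real.sqrt_div_self', one_div]; ring
  have hpt : Real.sqrt ν * Real.sqrt β * (Real.sqrt (T - tb) / Real.sqrt β) = Real.sqrt (T - tb) * Real.sqrt ν := by
    field_simp
  simp only [physWindowField, smul_stPull_apply, zero_add, htime, smul_smul]
  rw [ha, hlam, hcoef, hpt]

/-! ## §2 The one new estimate of the frame, as a text -/

/-- **POINTWISE ANNULAR PRESSURE BOUND (1.16) IN THE PINEAU–VICOL FRAME** (to be proved in part 2; Sketch30v2 `FrameTransferS30`
docstring, ROUND-28 v2 plate P4 (ii)).  For the class `(ν, M, T, ρ, E₀)` there are a pressure level `C_p` and a scale `β`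
(`0 < β < min(T, ρ²)`, `λ = √(νβ) < ρ`) such that every classical Leray–Hopf solution on `[0,T)` with initial energy `≤ E₀` and
local Type I(`M`) on `Q_ρ(x₀, T)` admits a gauge point `x₁` for which the rescaled gauged pressure
`q(s,z) = (λ/ν)² (p − p(·,x₁))(T + βs, x₀ + λz)` obeys `|q(s,z)| ≤ C_p` for `s ∈ [−1,0)`, `1/2 < |z| < 3/4`.
[Near/mid/far split of the Riesz pressure: far by Type I near the apex + energy, near by the Type-I gradient envelope and the
mean-zero Calderón–Zygmund kernel; Seregin–Šverák gauge.] -/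
def AnnularPressureBoundS30 : Prop :=
  ∀ ν : ℝ, 0 < ν → ∀ (M T ρ E₀ : ℝ), 0 < T → 0 < ρ →
    ∃ Cp : ℝ, 0 < Cp ∧ ∃ β : ℝ, 0 < β ∧ β < T ∧ β < ρ ^ 2 ∧ Real.sqrt (ν * β) < ρ ∧
    ∀ (u : ℝ → EuclideanSpace ℝ (Fin 3) → EuclideanSpace ℝ (Fin 3)) (p : ℝ → EuclideanSpace ℝ (Fin 3) → ℝ),
      IsClassicalNSSolutionOn (Set.Ico 0 T) ν 0 u p → IsLerayHopfOn T ν 0 (u 0) u → HasRapidSpatialDecay (u 0) →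
      VectorCalculus.kineticEnergy (u 0) ≤ E₀ →
      ∀ x₀ : EuclideanSpace ℝ (Fin 3),
        (∀ t ∈ Set.Ico 0 T, T - ρ ^ 2 < t → ∀ x ∈ Metric.ball x₀ ρ, ‖u t x‖ * (‖x - x₀‖ + Real.sqrt (ν * (T - t))) ≤ M) →
        ∃ x₁ : EuclideanSpace ℝ (Fin 3), ∀ s ∈ Ico (-1 : ℝ) 0, ∀ z : EuclideanSpace ℝ (Fin 3), 1 / 2 < ‖z‖ → ‖z‖ < 3 / 4 →
          |((Real.sqrt (ν * β) / ν) ^ 2 • stPull β (Real.sqrt (ν * β)) T x₀ (fun t x => p t x - p t x₁)) s z| ≤ Cp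

/-! ## §3 The frame reduction -/

/-- **P4 reduction: `AnnularPressureBoundS30 → FrameTransferS30`.**  Given the pointwise annular pressure bound, the
Pineau–Vicol-frame door `PVVortexDefectPeepholeRegularity` implies the physical door `TargetVortexDefectPeephole`:
`C_u = |M|/ν + 1`, peephole `(y₀/√ν, r/√ν)` with the same `ε` (covariance §1), class pressure level `C_p` and scale `β` from
the text, lateness `t⋆ = T − e^{−s₀(C_p)}β`. -/
theorem frameTransferS30_of_annularPressure (hP : AnnularPressureBoundS30) : FrameTransferS30 := by
  intro h ν hν M y₀ r hr
  -- the Pineau–Vicol-frame constants of `(ν, M, y₀, r)`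
  set Cu : ℝ := |M| / ν + 1 with hCu_def
  have hCu : 0 < Cu := by positivity
  have hMCu : M / ν ≤ Cu := by
    have h1 : M / ν ≤ |M| / ν := div_le_div_of_nonneg_right (le_abs_self M) hν.le
    linarith
  have hsν : 0 < Real.sqrt ν := Real.sqrt_pos.2 hν
  set y₀' : EuclideanSpace ℝ (Fin 3) := (Real.sqrt ν)⁻¹ • y₀ with hy₀'
  set r' : ℝ := r / Real.sqrt ν with hr'_def
  have hr' : 0 < r' := div_pos hr hsν
  obtain ⟨ε, hε, Hd⟩ := h Cu hCu y₀' r' hr'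
  refine ⟨ε, hε, fun T ρ E₀ hT hρ => ?_⟩
  obtain ⟨Cp, hCp, β, hβ, hβT, hβρ, hlamρ, HP⟩ := hP ν hν M T ρ E₀ hT hρ
  set lam : ℝ := Real.sqrt (ν * β) with hlam_def
  have hlam : 0 < lam := Real.sqrt_pos.2 (by positivity)
  have hlam2 : lam ^ 2 = ν * β := Real.sq_sqrt (by positivity)
  obtain ⟨s₀, -, Hs⟩ := Hd Cp hCp
  have hexp : 0 < Real.exp (-s₀) := Real.exp_pos _
  refine ⟨T - Real.exp (-s₀) * β, by nlinarith, ?_⟩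
  intro u p hsol hLH hdec hE x₀ hM tb htb hpeep
  obtain ⟨x₁, hx₁⟩ := HP u p hsol hLH hdec hE x₀ hM
  set v : ℝ → EuclideanSpace ℝ (Fin 3) → EuclideanSpace ℝ (Fin 3) := (lam / ν) • stPull β lam T x₀ u with hv_def
  set q : ℝ → EuclideanSpace ℝ (Fin 3) → ℝ :=
    (lam / ν) ^ 2 • stPull β lam T x₀ (fun t x => p t x - p t x₁) with hq_def
  have hreg : IsClassicalNSSolutionOnRegion
      (Ico (-1 : ℝ) 0 ×ˢ ball (0 : EuclideanSpace ℝ (Fin 3)) 1) 1 0 v q :=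
    pvFrame_isClassical hν hsol hβ hβT x₀ x₁
  -- (1.15) with `C_u = |M|/ν + 1`
  have hI : ∀ s ∈ Ico (-1 : ℝ) 0, ∀ z ∈ ball (0 : EuclideanSpace ℝ (Fin 3)) 1,
      ‖v s z‖ ≤ Cu / (Real.sqrt (-s) + ‖z‖) :=
    pv_typeI_transfer hν hβT hβρ hlam hlam2 hlamρ hMCu hM
  -- (1.16), pointwise, from the text
  have hPq : ∀ s ∈ Ico (-1 : ℝ) 0, ∀ z : EuclideanSpace ℝ (Fin 3), 1 / 2 < ‖z‖ → ‖z‖ < 3 / 4 → |q s z| ≤ Cp := hx₁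
  -- the slice time in the Pineau–Vicol frame
  have htbT : tb < T := htb.2
  set sb : ℝ := (tb - T) / β with hsb_def
  have hsb0 : sb < 0 := div_neg_of_neg_of_pos (by linarith) hβ
  have hsb1 : -Real.exp (-s₀) < sb := by
    rw [hsb_def, lt_div_iff₀ hβ]
    linarith [htb.1]
  -- the peephole datum in the Pineau–Vicol frame (covariance)
  have hwin : physWindowField 0 0 v sb = fun z => (Real.sqrt ν)⁻¹ • physWindowField T x₀ u tb (Real.sqrt ν • z) :=
    physWindowField_pvFrame hν hβ x₀ u
  have hν2 : Real.sqrt ν ^ 2 = ν := Real.sq_sqrt hν.le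
  have hpeep' : ∀ z ∈ ball y₀' r', ‖vortexDefect 1 (physWindowField 0 0 v sb) z‖ ≤ ε := by
    intro z hz
    have hy : Real.sqrt ν • z ∈ ball y₀ r := by
      rw [mem_ball, dist_eq_norm] at hz ⊢
      have e : Real.sqrt ν • z - y₀ = Real.sqrt ν • (z - y₀') := by
        rw [hy₀', smul_sub, smul_smul, mul_inv_cancel₀ hsν.ne', one_smul]
      rw [e, norm_smul, Real.norm_of_nonneg hsν.le]
      calc Real.sqrt ν * ‖z - y₀'‖ < Real.sqrt ν * r' := mul_lt_mul_of_pos_left hz hsν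
        _ = r := by rw [hr'_def]; field_simp
    rw [hwin, vortexDefect_inv_smul_comp_smul _ hsν, hν2]
    exact hpeep _ hy
  -- Theorem-1.9-type conclusion in the Pineau–Vicol frame, pulled back to `Q_{r₀}(x₀, T)`
  obtain ⟨ϱ, hϱ, B, hB⟩ := Hs v q hreg hI hPq sb hsb1 hsb0 hpeep'
  exact isBackwardBoundedAt_of_pv_bound hν hβ hlam hϱ hB

end Summit.NavierStokesRegularity.NavierStokesRegularity.Theorems.ScalingDefectPeepholeDoor

end
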